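import Mathlib.Analysis.InnerProductSpace.Rayleigh
import Mathlib.Analysis.Normed.Operator.Compact.FredholmAlternative
import Literature.Analysis.OperatorTheory.PositivityImproving
import HarnessLib

/-!
# Spectral gap of a compact, self-adjoint, positivity improving operator
# (Jentzsch / Kreĭn–Rutman; Reed–Simon IV, Thms XIII.43–44 in the compact case) — PROVED

Topic `Literature/Analysis/OperatorTheory`; companion of `PositivityImproving.lean` (which proves,
for a bounded self-adjoint positivity improving `A` on the real `L²(M, dμ)`, that IF `‖A‖` is an
eigenvalue then it is simple with an a.e. strictly positive eigenvector,
`IsPositivityImproving.simple_top_eigenvalue`). Written for the transfer-operator proof of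
uniqueness / exponential mixing of one-dimensional Gibbs states with strictly positive
Hilbert–Schmidt transfer kernels (1-D unbounded-spin chains: Cassandro–Olivieri–Pellegrinotti–Presutti
1978; the pinned anharmonic chain of `Literature.MathematicalPhysics.KineticTheory.HeatConduction`),
where the transfer operator is compact, self-adjoint and positivity improving and one needs the
convergence `‖A‖⁻ⁿ Aⁿ g → ⟪φ, g⟫ φ` at a geometric rate. Everything here is PROVED (no named facts,
no definitions):

* `exists_eigenvector_norm_or_neg_norm` — a nonzero compact self-adjoint operator on a real Hilbert
  space has an eigenvector for `‖T‖` or for `-‖T‖` (Mathlib's Rayleigh-quotient estimate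
  `ContinuousLinearMap.abs_rayleighQuotient_le_of_norm_mem_resolventSet` puts `±‖T‖` in the spectrum;
  `IsCompactOperator.hasEigenvalue_iff_mem_spectrum` makes it an eigenvalue);
* `norm_pow_apply_sub_le_of_gap` — abstract bookkeeping: `Aφ = λ₀φ`, `‖φ‖ = 1`, `A` self-adjoint and
  `‖Aw‖ ≤ θ‖w‖` on `φ^⊥` give `‖Aⁿg - λ₀ⁿ⟪φ, g⟫φ‖ ≤ θⁿ‖g‖`;
* `IsPositivityImproving.abs_eigen_of_abs_eq_norm` — `Aψ = sψ`, `|s| = ‖A‖` ⟹ `A|ψ| = ‖A‖|ψ|`;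
* `IsPositivityImproving.eq_zero_of_eigen_neg_norm` — `-‖A‖` is NOT an eigenvalue (`A ≠ 0`);
* `IsPositivityImproving.exists_top_eigenvector_of_isCompactOperator` — compactness supplies the
  top eigenvector assumed in `simple_top_eigenvalue`;
* `IsPositivityImproving.exists_spectralGap` (**main**) — for `A ≠ 0` compact, self-adjoint,
  positivity improving: a unit, a.e. strictly positive `φ` with `Aφ = ‖A‖φ` spanning the
  `‖A‖`-eigenspace, and `θ < ‖A‖` with `‖Aw‖ ≤ θ‖w‖` for all `w ⊥ φ` (deflation
  `B = A - ‖A‖⟪φ, ·⟫φ`: compact, self-adjoint, `‖B‖ ≤ ‖A‖`, and `‖B‖ = ‖A‖` would produce a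
  `±‖A‖`-eigenvector of `A` orthogonal to `φ`);
* `IsPositivityImproving.exists_norm_pow_sub_le` — the two combined:
  `‖Aⁿ g - ‖A‖ⁿ ⟪φ, g⟫ φ‖ ≤ θⁿ ‖g‖`.

Printed sources: Reed–Simon IV, §XIII.12, Thms XIII.43–44 (nondegeneracy of the ground state; the
compact case is Jentzsch's theorem, Notes to §XIII.12) [`ReedSimonIV1978`]; Reed–Simon I,
Thm. VI.16 (`±‖T‖` is an eigenvalue of a compact self-adjoint `T ≠ 0`) [`ReedSimonI1980`]. The gap
is the standard corollary "`σ(A) ∖ {‖A‖} ⊆ [-θ, θ]`" of simplicity + exclusion of `-‖A‖` +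
discreteness of the nonzero spectrum; proved here by deflation (no Hilbert basis of eigenvectors).
Tree search (`'Jentzsch|KreinRutman|positivity.?improving|spectralGap'`): only
`PositivityImproving.lean`, `BeurlingDeny.lean`, and the complex-scalar `TransferData` of
`Literature.Probability.LatticeModels` (a contraction WITH a given gap); nothing proves a gap.
-/

noncomputable section

open MeasureTheory Module End
open scoped RealInnerProductSpace ENNReal

namespace Literature.Analysis.OperatorTheory

/-! ### Compact self-adjoint operators on a real Hilbert space attain their norm as `±`eigenvalue -/

section Abstract

variable {E : Type*} [NormedAddCommGroup E] [InnerProductSpace ℝ E] [CompleteSpace E]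

/-- **A nonzero compact self-adjoint operator on a real Hilbert space has an eigenvector for the
eigenvalue `‖T‖` or `-‖T‖`** (Riesz–Schauder / Hilbert–Schmidt theory: `‖T‖ = sup |⟪Tx, x⟫|/‖x‖²`,
so `‖T‖` or `-‖T‖` lies in the spectrum — Mathlib's Rayleigh-quotient estimate
`abs_rayleighQuotient_le_of_norm_mem_resolventSet` — and a nonzero spectral value of a compact
operator is an eigenvalue, `IsCompactOperator.hasEigenvalue_iff_mem_spectrum`;
Reed–Simon I, Thm. VI.16 and its proof). [folklore] -/
theorem exists_eigenvector_norm_or_neg_norm {T : E →L[ℝ] E} (hT : IsSelfAdjoint T)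
    (hc : IsCompactOperator T) (h0 : T ≠ 0) :
    ∃ ψ : E, ψ ≠ 0 ∧ (T ψ = ‖T‖ • ψ ∨ T ψ = (-‖T‖) • ψ) := by
  have _inst : Nontrivial E := by
    by_contra hE
    rw [not_nontrivial_iff_subsingleton] at hE
    exact h0 (Subsingleton.elim _ _)
  have hTn : ‖T‖ ≠ 0 := norm_ne_zero_iff.mpr h0
  -- `‖T‖` or `-‖T‖` lies in the spectrum
  have hmem : (‖T‖ : ℝ) ∈ spectrum ℝ T ∨ (-‖T‖ : ℝ) ∈ spectrum ℝ T := by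
    by_contra hres
    push Not at hres
    have h1 : algebraMap ℝ ℝ ‖T‖ ∈ resolventSet ℝ T := by
      rw [spectrum.mem_resolventSet_iff]
      have := hres.1
      rwa [spectrum.mem_iff, not_not] at this
    have h2 : -algebraMap ℝ ℝ ‖T‖ ∈ resolventSet ℝ T := by
      rw [spectrum.mem_resolventSet_iff]
      have := hres.2
      rwa [spectrum.mem_iff, not_not] at this
    obtain ⟨ε, hε, hle⟩ := T.abs_rayleighQuotient_le_of_norm_mem_resolventSet h1 h2
    have hsup := T.norm_eq_iSup_rayleighQuotient hT.isSymmetric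
    have : ‖T‖ ≤ ‖T‖ - ε := hsup.le.trans (ciSup_le fun x => hle x)
    linarith
  rcases hmem with hmem | hmem
  · have hev : HasEigenvalue (T : End ℝ E) ‖T‖ :=
      (IsCompactOperator.hasEigenvalue_iff_mem_spectrum hc hTn).mpr hmem
    obtain ⟨v, hv⟩ := hev.exists_hasEigenvector
    exact ⟨v, hv.2, Or.inl hv.apply_eq_smul⟩
  · have hev : HasEigenvalue (T : End ℝ E) (-‖T‖) :=
      (IsCompactOperator.hasEigenvalue_iff_mem_spectrum hc (neg_ne_zero.2 hTn)).mpr hmem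
    obtain ⟨v, hv⟩ := hev.exists_hasEigenvector
    exact ⟨v, hv.2, Or.inr hv.apply_eq_smul⟩

omit [CompleteSpace E] in
/-- For a unit vector `φ`, the component of `g` orthogonal to `φ` is orthogonal to `φ` and no
longer than `g`. [folklore] -/
theorem inner_sub_inner_smul_eq_zero_and_norm_le {φ : E} (hφ : ‖φ‖ = 1) (g : E) :
    ⟪φ, g - ⟪φ, g⟫ • φ⟫ = 0 ∧ ‖g - ⟪φ, g⟫ • φ‖ ≤ ‖g‖ := by
  have hφφ : ⟪φ, φ⟫ = 1 := by rw [real_inner_self_eq_norm_sq, hφ, one_pow]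
  have hwo : ⟪φ, g - ⟪φ, g⟫ • φ⟫ = 0 := by
    rw [inner_sub_right, real_inner_smul_right, hφφ, mul_one, sub_self]
  refine ⟨hwo, ?_⟩
  set w := g - ⟪φ, g⟫ • φ with hw
  have hg : g = ⟪φ, g⟫ • φ + w := by rw [hw]; abel
  have hwo' : ⟪w, φ⟫ = 0 := by rw [real_inner_comm]; exact hwo
  have h1 : ‖g‖ ^ 2 = ⟪φ, g⟫ ^ 2 + ‖w‖ ^ 2 := by
    have : ‖g‖ ^ 2 = ‖⟪φ, g⟫ • φ + w‖ ^ 2 := by rw [← hg]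
    rw [this, ← real_inner_self_eq_norm_sq, ← real_inner_self_eq_norm_sq]
    simp only [inner_add_left, inner_add_right, real_inner_smul_left, real_inner_smul_right,
      hφφ, hwo, hwo']
    ring
  nlinarith [sq_nonneg ⟪φ, g⟫, norm_nonneg w, norm_nonneg g]

/-- **Geometric convergence of the powers from a gap on the orthogonal complement.** Let `A` be a
bounded self-adjoint operator on a real Hilbert space, `φ` a unit vector with `Aφ = λ₀ φ`, and
suppose `‖Aw‖ ≤ θ‖w‖` for every `w ⊥ φ`. Then for every `n` and `g`,
`‖Aⁿ g - λ₀ⁿ ⟪φ, g⟫ φ‖ ≤ θⁿ ‖g‖` (`φ^⊥` is invariant, `Aⁿ` acts on it with norm `≤ θⁿ`, and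
`g = ⟪φ, g⟫ φ + w` with `‖w‖ ≤ ‖g‖`). [folklore] -/
theorem norm_pow_apply_sub_le_of_gap {A : E →L[ℝ] E} (hA : IsSelfAdjoint A) {φ : E}
    (hφ : ‖φ‖ = 1) {lam₀ : ℝ} (hAφ : A φ = lam₀ • φ) {θ : ℝ} (hθ : 0 ≤ θ)
    (hgap : ∀ w : E, ⟪φ, w⟫ = 0 → ‖A w‖ ≤ θ * ‖w‖) (n : ℕ) (g : E) :
    ‖(A ^ n) g - (lam₀ ^ n * ⟪φ, g⟫) • φ‖ ≤ θ ^ n * ‖g‖ := by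
  -- invariance of `φ^⊥`
  have hinv : ∀ w : E, ⟪φ, w⟫ = 0 → ⟪φ, A w⟫ = 0 := by
    intro w hw
    rw [← hA.isSymmetric.apply_clm, hAφ, real_inner_smul_left, hw, mul_zero]
  -- powers on `φ^⊥`
  have hpow : ∀ (k : ℕ) (w : E), ⟪φ, w⟫ = 0 → ⟪φ, (A ^ k) w⟫ = 0 ∧ ‖(A ^ k) w‖ ≤ θ ^ k * ‖w‖ := by
    intro k
    induction k with
    | zero => intro w hw; simp [hw]
    | succ k ih =>
      intro w hw
      obtain ⟨h1, h2⟩ := ih w hw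
      rw [pow_succ', mul_apply_eq_comp]
      refine ⟨hinv _ h1, ?_⟩
      calc ‖A ((A ^ k) w)‖ ≤ θ * ‖(A ^ k) w‖ := hgap _ h1
        _ ≤ θ * (θ ^ k * ‖w‖) := by gcongr
        _ = θ ^ (k + 1) * ‖w‖ := by rw [pow_succ']; ring
  -- powers on `φ`
  have hφpow : ∀ k : ℕ, (A ^ k) φ = lam₀ ^ k • φ := by
    intro k
    induction k with
    | zero => simp
    | succ k ih =>
      rw [pow_succ', mul_apply_eq_comp, ih, map_smul, hAφ, smul_smul, ← pow_succ]
  obtain ⟨hwo, hwn⟩ := inner_sub_inner_smul_eq_zero_and_norm_le hφ g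
  have hg : g = ⟪φ, g⟫ • φ + (g - ⟪φ, g⟫ • φ) := by abel
  have hAg : (A ^ n) g = (lam₀ ^ n * ⟪φ, g⟫) • φ + (A ^ n) (g - ⟪φ, g⟫ • φ) := by
    conv_lhs => rw [hg]
    rw [map_add, map_smul, hφpow, smul_smul, mul_comm ⟪φ, g⟫]
  rw [hAg, add_sub_cancel_left]
  calc ‖(A ^ n) (g - ⟪φ, g⟫ • φ)‖ ≤ θ ^ n * ‖g - ⟪φ, g⟫ • φ‖ := (hpow n _ hwo).2
    _ ≤ θ ^ n * ‖g‖ := by gcongr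

end Abstract

/-! ### Positivity improving compact operators: the gap below the top eigenvalue -/

section Improving

variable {M : Type*} [MeasurableSpace M] {μ : Measure M} {A : Lp ℝ 2 μ →L[ℝ] Lp ℝ 2 μ}

/-- If `A` is self-adjoint and positivity improving and `Aψ = sψ` with `|s| = ‖A‖`, then `|ψ|` is a
top eigenvector: `A|ψ| = ‖A‖ |ψ|` (Reed–Simon IV, proof of Thm XIII.43: `⟪|ψ|, A|ψ|⟫ ≥ ⟪|ψ|, |Aψ|⟫
= ‖A‖‖ψ‖²` and the variational characterisation of `‖A‖`; the case `s = -‖A‖` is what excludes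
`-‖A‖` from the point spectrum below). [cite: ReedSimonIV1978, Thm XIII.43 (proof, pp. 202–203)] -/
theorem IsPositivityImproving.abs_eigen_of_abs_eq_norm (hA : IsSelfAdjoint A)
    (hImp : IsPositivityImproving A) {ψ : Lp ℝ 2 μ} {s : ℝ} (hs : |s| = ‖A‖)
    (hψ : A ψ = s • ψ) : A |ψ| = ‖A‖ • |ψ| := by
  refine apply_eq_norm_smul_of_le_inner (fun x y => hA.isSymmetric x y) ?_
  -- `⟪|ψ|, |Aψ|⟫ = |s| ‖ψ‖²`
  have hint : Integrable (fun x => |ψ| x * |A ψ x|) μ := by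
    refine (integrable_mul |ψ| |A ψ|).congr ?_
    filter_upwards [Lp.coeFn_abs (A ψ)] with x hx
    rw [hx]
  have h2 : ∫ x, |ψ| x * |A ψ x| ∂μ = ‖A‖ * ‖ψ‖ ^ 2 := by
    have h3 : ∫ x, |ψ| x * |A ψ x| ∂μ = ∫ x, |s| * (ψ x * ψ x) ∂μ := by
      refine integral_congr_ae ?_
      filter_upwards [Lp.coeFn_abs ψ, Lp.coeFn_smul s ψ] with x habs hsm
      rw [habs, hψ, hsm, Pi.smul_apply, smul_eq_mul, abs_mul, ← abs_mul_abs_self (ψ x)]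
      ring
    rw [h3, integral_const_mul, ← inner_eq_integral, real_inner_self_eq_norm_sq, hs]
  calc ‖A‖ * ‖|ψ|‖ ^ 2 = ‖A‖ * ‖ψ‖ ^ 2 := by rw [norm_abs_eq_norm]
    _ = ∫ x, |ψ| x * |A ψ x| ∂μ := h2.symm
    _ ≤ ⟪|ψ|, A |ψ|⟫ := by
        rw [inner_eq_integral]
        refine integral_mono_ae hint (integrable_mul _ _) ?_
        filter_upwards [hImp.abs_apply_le ψ, Lp.coeFn_abs ψ] with x hx habs
        have h0 : 0 ≤ |ψ| x := by rw [habs]; exact abs_nonneg _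
        exact mul_le_mul_of_nonneg_left hx h0

/-- **`-‖A‖` is not an eigenvalue of a nonzero self-adjoint positivity improving operator**: if
`Aψ = -‖A‖ψ` then `ψ = 0`. (With `λ = ‖A‖ > 0` and `A|ψ| = λ|ψ|`: `A(|ψ| + ψ) = λ(|ψ| - ψ)` and
`A(|ψ| - ψ) = λ(|ψ| + ψ)`; both `|ψ| ± ψ` are nonzero and nonnegative, so positivity improvement makes
`|ψ| - ψ` and `|ψ| + ψ` a.e. strictly positive, i.e. `ψ < 0` and `ψ > 0` a.e. — absurd unless `μ = 0`.)
(Reed–Simon IV, Thm XIII.43–44: the top of the spectrum is nondegenerate; Kreĭn–Rutman.)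
[cite: ReedSimonIV1978, Thm XIII.43 and Thm XIII.44] -/
theorem IsPositivityImproving.eq_zero_of_eigen_neg_norm (hA : IsSelfAdjoint A)
    (hImp : IsPositivityImproving A) (h0 : A ≠ 0) {ψ : Lp ℝ 2 μ}
    (hψ : A ψ = (-‖A‖) • ψ) : ψ = 0 := by
  by_contra hψ0
  set lam := ‖A‖ with hlam
  have hlam0 : 0 < lam := norm_pos_iff.2 h0
  have habs : A |ψ| = lam • |ψ| :=
    hImp.abs_eigen_of_abs_eq_norm hA (s := -lam) (by rw [abs_neg, abs_of_pos hlam0]) hψ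
  -- `|ψ| ± ψ`
  have hgp : 0 ≤ |ψ| + ψ := neg_le_iff_add_nonneg.1 (neg_le_abs ψ)
  have hgm : 0 ≤ |ψ| - ψ := sub_nonneg.2 (le_abs_self ψ)
  have hAp : A (|ψ| + ψ) = lam • (|ψ| - ψ) := by
    rw [map_add, habs, hψ, neg_smul, smul_sub, sub_eq_add_neg]
  have hAm : A (|ψ| - ψ) = lam • (|ψ| + ψ) := by
    rw [map_sub, habs, hψ, neg_smul, sub_neg_eq_add, smul_add]
  -- both are nonzero
  have hkey : ∀ {ξ : Lp ℝ 2 μ}, A ξ = lam • ξ → A ξ = (-lam) • ξ → ξ = 0 := by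
    intro ξ h1 h2
    have h3 : (2 * lam) • ξ = 0 := by
      rw [mul_smul, two_smul]
      nth_rewrite 1 [← h1]
      rw [h2, neg_smul, neg_add_cancel]
    rcases smul_eq_zero.1 h3 with h | h
    · exact absurd h (by positivity)
    · exact h
  have hp0 : |ψ| + ψ ≠ 0 := by
    intro h
    have h' : |ψ| = -ψ := eq_neg_of_add_eq_zero_left h
    apply hψ0
    refine hkey ?_ hψ
    have := habs
    rw [h', map_neg, smul_neg, neg_inj] at this
    exact this
  have hm0 : |ψ| - ψ ≠ 0 := by
    intro h
    have h' : |ψ| = ψ := sub_eq_zero.1 h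
    apply hψ0
    refine hkey ?_ hψ
    rw [← h']
    exact habs
  -- positivity improvement
  have hsp : IsStrictlyPositiveFun (|ψ| - ψ) := by
    have h := hImp _ ⟨hgp, hp0⟩
    rw [hAp] at h
    unfold IsStrictlyPositiveFun at h ⊢
    filter_upwards [h, Lp.coeFn_smul lam (|ψ| - ψ)] with x hx hsm
    rw [hsm, Pi.smul_apply, smul_eq_mul] at hx
    exact pos_of_mul_pos_right hx hlam0.le
  have hsm' : IsStrictlyPositiveFun (|ψ| + ψ) := by
    have h := hImp _ ⟨hgm, hm0⟩
    rw [hAm] at h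
    unfold IsStrictlyPositiveFun at h ⊢
    filter_upwards [h, Lp.coeFn_smul lam (|ψ| + ψ)] with x hx hsm
    rw [hsm, Pi.smul_apply, smul_eq_mul] at hx
    exact pos_of_mul_pos_right hx hlam0.le
  have hfalse : ∀ᵐ x ∂μ, False := by
    filter_upwards [hsp, hsm', Lp.coeFn_sub |ψ| ψ, Lp.coeFn_add |ψ| ψ, Lp.coeFn_abs ψ] with x h1 h2
      hsub hadd habs'
    rw [hsub, Pi.sub_apply, habs'] at h1
    rw [hadd, Pi.add_apply, habs'] at h2
    rcases le_or_gt 0 (ψ x) with h | h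
    · rw [abs_of_nonneg h] at h1; linarith
    · rw [abs_of_neg h] at h2; linarith
  exact measure_ne_zero_of_ne_zero hψ0
    (MeasureTheory.ae_eq_bot.1 (Filter.eventually_false_iff_eq_bot.1 hfalse))

/-- **A nonzero compact self-adjoint positivity improving operator has a top eigenvector**: there is
`ψ ≠ 0` with `Aψ = ‖A‖ψ` (a `±‖A‖`-eigenvector exists by compactness, and the absolute value of a
`-‖A‖`-eigenvector is a `‖A‖`-eigenvector). This discharges the hypothesis "`‖A‖` is an eigenvalue"
of `IsPositivityImproving.simple_top_eigenvalue` (Reed–Simon IV, Thm XIII.43) in the compact case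
(Jentzsch's theorem; Reed–Simon IV, Thm XIII.43–44 with XIII.64-type compactness).
[cite: ReedSimonIV1978, Thm XIII.43 and Thm XIII.44] -/
theorem IsPositivityImproving.exists_top_eigenvector_of_isCompactOperator (hA : IsSelfAdjoint A)
    (hImp : IsPositivityImproving A) (hc : IsCompactOperator A) (h0 : A ≠ 0) :
    ∃ ψ : Lp ℝ 2 μ, ψ ≠ 0 ∧ A ψ = ‖A‖ • ψ := by
  obtain ⟨ψ, hψ0, hψ | hψ⟩ := exists_eigenvector_norm_or_neg_norm hA hc h0
  · exact ⟨ψ, hψ0, hψ⟩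
  · refine ⟨|ψ|, ?_, hImp.abs_eigen_of_abs_eq_norm hA (s := -‖A‖) (by simp) hψ⟩
    rw [← norm_ne_zero_iff, norm_abs_eq_norm, norm_ne_zero_iff]
    exact hψ0

/-- **Spectral gap of a compact, self-adjoint, positivity improving operator (Jentzsch /
Kreĭn–Rutman / Reed–Simon XIII.43–44).** Let `A ≠ 0` be compact, self-adjoint and positivity
improving on the real `L²(M, dμ)`. Then `λ₀ = ‖A‖` is a simple eigenvalue with a unit, a.e. strictly
positive eigenvector `φ` (every `η` with `Aη = ‖A‖η` equals `⟪φ, η⟫ φ`), and `A` has a GAP on `φ^⊥`: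
there is `θ < ‖A‖` with `‖Aw‖ ≤ θ‖w‖` for all `w ⊥ φ`. Proof: the deflated operator
`B = A - ‖A‖ ⟪φ, ·⟫ φ` is compact and self-adjoint with `‖B‖ ≤ ‖A‖`; if `‖B‖ = ‖A‖`, a
`±‖A‖`-eigenvector of `B` would be a `±‖A‖`-eigenvector of `A` orthogonal to `φ` — impossible by
simplicity (`+`) and by `eq_zero_of_eigen_neg_norm` (`-`); take `θ = ‖B‖`.
[cite: ReedSimonIV1978, Thm XIII.43 and Thm XIII.44] -/
theorem IsPositivityImproving.exists_spectralGap (hA : IsSelfAdjoint A)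
    (hImp : IsPositivityImproving A) (hc : IsCompactOperator A) (h0 : A ≠ 0) :
    ∃ φ : Lp ℝ 2 μ, ‖φ‖ = 1 ∧ IsStrictlyPositiveFun φ ∧ A φ = ‖A‖ • φ ∧
      (∀ η : Lp ℝ 2 μ, A η = ‖A‖ • η → η = ⟪φ, η⟫ • φ) ∧
      ∃ θ : ℝ, 0 ≤ θ ∧ θ < ‖A‖ ∧ ∀ w : Lp ℝ 2 μ, ⟪φ, w⟫ = 0 → ‖A w‖ ≤ θ * ‖w‖ := by
  obtain ⟨φ, hφ1, hφpos, hAφ, hsimple⟩ := hImp.simple_top_eigenvalue hA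
    (hImp.exists_top_eigenvector_of_isCompactOperator hA hc h0)
  refine ⟨φ, hφ1, hφpos, hAφ, hsimple, ?_⟩
  have hlam0 : 0 < ‖A‖ := norm_pos_iff.2 h0
  have hφφ : ⟪φ, φ⟫ = 1 := by rw [real_inner_self_eq_norm_sq, hφ1, one_pow]
  -- invariance of `φ^⊥`
  have hinv : ∀ w : Lp ℝ 2 μ, ⟪φ, w⟫ = 0 → ⟪φ, A w⟫ = 0 := by
    intro w hw
    rw [← hA.isSymmetric.apply_clm, hAφ, real_inner_smul_left, hw, mul_zero]
  -- the rank-one operator `R g = ⟪φ, g⟫ φ` and the deflated operator `B = A - ‖A‖ R`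
  set R : Lp ℝ 2 μ →L[ℝ] Lp ℝ 2 μ :=
    (ContinuousLinearMap.toSpanSingleton ℝ φ).comp (innerSL ℝ φ) with hRdef
  have hR : ∀ g, R g = ⟪φ, g⟫ • φ := fun g => by
    simp [hRdef, ContinuousLinearMap.toSpanSingleton_apply, innerSL_apply_apply]
  set B : Lp ℝ 2 μ →L[ℝ] Lp ℝ 2 μ := A - ‖A‖ • R with hBdef
  have hB : ∀ g, B g = A (g - ⟪φ, g⟫ • φ) := fun g => by
    simp only [hBdef, sub_apply, smul_apply, hR,
      map_sub, map_smul, hAφ, smul_smul, mul_comm]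
  have hBw : ∀ w, ⟪φ, w⟫ = 0 → B w = A w := fun w hw => by
    rw [hB, hw, zero_smul, sub_zero]
  have hBorth : ∀ g, ⟪φ, B g⟫ = 0 := fun g => by
    rw [hB]
    exact hinv _ (inner_sub_inner_smul_eq_zero_and_norm_le hφ1 g).1
  -- `B` is compact
  have hRc : IsCompactOperator R :=
    (isCompactOperator_of_locallyCompactSpace_rng
      (ContinuousLinearMap.toSpanSingleton ℝ φ)).comp_clm (innerSL ℝ φ)
  have hBc : IsCompactOperator B := by
    rw [hBdef, FunLike.coe_sub, FunLike.coe_smul]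
    exact hc.sub (hRc.smul ‖A‖)
  -- `B` is self-adjoint
  have hBsa : IsSelfAdjoint B := by
    rw [ContinuousLinearMap.isSelfAdjoint_iff_isSymmetric]
    intro x y
    change ⟪B x, y⟫ = ⟪x, B y⟫
    simp only [hBdef, sub_apply, smul_apply, hR,
      inner_sub_left, inner_sub_right, real_inner_smul_left, real_inner_smul_right,
      hA.isSymmetric.apply_clm x y, real_inner_comm φ x]
    ring
  -- `‖B‖ ≤ ‖A‖`
  have hBle : ‖B‖ ≤ ‖A‖ := by
    refine ContinuousLinearMap.opNorm_le_bound _ (norm_nonneg _) fun g => ?_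
    rw [hB]
    calc ‖A (g - ⟪φ, g⟫ • φ)‖ ≤ ‖A‖ * ‖g - ⟪φ, g⟫ • φ‖ := A.le_opNorm _
      _ ≤ ‖A‖ * ‖g‖ := by
          gcongr
          exact (inner_sub_inner_smul_eq_zero_and_norm_le hφ1 g).2
  -- `‖B‖ < ‖A‖`
  have hBlt : ‖B‖ < ‖A‖ := by
    refine lt_of_le_of_ne hBle fun heq => ?_
    have hB0 : B ≠ 0 := by
      rw [← norm_ne_zero_iff, heq]; exact hlam0.ne'
    obtain ⟨ξ, hξ0, hξ⟩ := exists_eigenvector_norm_or_neg_norm hBsa hBc hB0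
    rw [heq] at hξ
    -- `ξ ⊥ φ`
    have hξφ : ⟪φ, ξ⟫ = 0 := by
      have h1 := hBorth ξ
      rcases hξ with hξ | hξ
      · rw [hξ, real_inner_smul_right] at h1
        exact (mul_eq_zero.1 h1).resolve_left hlam0.ne'
      · rw [hξ, real_inner_smul_right] at h1
        exact (mul_eq_zero.1 h1).resolve_left (neg_ne_zero.2 hlam0.ne')
    rw [hBw ξ hξφ] at hξ
    rcases hξ with hξ | hξ
    · -- `+‖A‖`: simplicity
      have := hsimple ξ hξ
      rw [hξφ, zero_smul] at this
      exact hξ0 this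
    · -- `-‖A‖`: excluded
      exact hξ0 (hImp.eq_zero_of_eigen_neg_norm hA h0 hξ)
  refine ⟨‖B‖, norm_nonneg _, hBlt, fun w hw => ?_⟩
  rw [← hBw w hw]
  exact B.le_opNorm w

/-- **Geometric convergence of the powers to the top eigenprojection (exponential mixing).** For
`A ≠ 0` compact, self-adjoint and positivity improving on the real `L²(M, dμ)`: a unit, a.e.
strictly positive top eigenvector `φ` and `θ < ‖A‖` with `‖Aⁿ g - ‖A‖ⁿ ⟪φ, g⟫ φ‖ ≤ θⁿ ‖g‖` for all
`n`, `g` (so `‖A‖⁻ⁿ Aⁿ g → ⟪φ, g⟫ φ` geometrically, uniformly on bounded sets).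
[cite: ReedSimonIV1978, Thm XIII.43 and Thm XIII.44] -/
theorem IsPositivityImproving.exists_norm_pow_sub_le (hA : IsSelfAdjoint A)
    (hImp : IsPositivityImproving A) (hc : IsCompactOperator A) (h0 : A ≠ 0) :
    ∃ φ : Lp ℝ 2 μ, ‖φ‖ = 1 ∧ IsStrictlyPositiveFun φ ∧ A φ = ‖A‖ • φ ∧
      ∃ θ : ℝ, 0 ≤ θ ∧ θ < ‖A‖ ∧
        ∀ (n : ℕ) (g : Lp ℝ 2 μ), ‖(A ^ n) g - (‖A‖ ^ n * ⟪φ, g⟫) • φ‖ ≤ θ ^ n * ‖g‖ := by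
  obtain ⟨φ, hφ1, hφpos, hAφ, -, θ, hθ0, hθ, hgap⟩ := hImp.exists_spectralGap hA hc h0
  exact ⟨φ, hφ1, hφpos, hAφ, θ, hθ0, hθ,
    norm_pow_apply_sub_le_of_gap hA hφ1 hAφ hθ0 hgap⟩

end Improving

end Literature.Analysis.OperatorTheory

end
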